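import Summits.CriticalPhenomena.PercolationContinuityZ3.Theorems.PercAnnulusCrossingSlabThm31
import Summits.CriticalPhenomena.PercolationContinuityZ3.Theorems.PercAnnulusCrossingSlabThm31OfSnapGadgets
import Literature.Probability.Percolation.SlabBoxCrossingPropertyCircuits
import HarnessLib

/-!
# NTW 2017, Corollary 3.2 at `p_c(S_k)`, UNCONDITIONAL — circuits in annuli, blocked annuli, polynomial decay of
# the one-arm probability on every critical slab

builds on p205010 (kernel theorem, internal audit signed; external expert review pending) — NOT used in this file.

Cell `prim-rsw3` (LANE 3), lead GEN 40.  Support file (`--supports stmt-CriticalPhenomena-4575`); no definitions, no named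
facts, no sorries.  With `NewmanTassionWu2017_thm31_holds` (p1 GEN 31, `T/PercAnnulusCrossingSlabThm31.lean`: NTW's
Theorem 3.1 = the box-crossing property at `p_c(S_k)` for every `k ≥ 1`, closing the lane's port of NTW §3) the conditional
corollaries of `Literature/…/SlabBoxCrossingPropertyCorollaries.lean` (p439353) and `…Circuits.lean` (p518891) become theorems:

* `NewmanTassionWu2017_cor32_i_holds` — open circuits: `∃ λ ≥ 1, c′ > 0, ∀ n ≥ 52, ∀ z, P_{p_c(S_k)}[circuitAround k z (λn) (2λn)] ≥ c′`;
* `NewmanTassionWu2017_cor32_ii_holds` — blocked annuli: `∃ c > 0, ∀ n ≥ 1, P_{p_c(S_k)}[B̄_n ⟷^{B̄_{2n}} ∂B̄_{2n}] ≤ 1 - c`;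
* `NewmanTassionWu2017_cor32_iii_holds` — polynomial one-arm decay: `∃ C, δ > 0, ∀ 1 ≤ m ≤ n,
  P_{p_c(S_k)}[B̄_m ⟷^{B̄_n} ∂B̄_n] ≤ C ((m+1)/(n+1))^δ` ("strengthens the result of [DST]", NTW p. 2).

References: C. M. Newman, V. Tassion, W. Wu, *Critical percolation and the minimal spanning tree in slabs*, CPAM 70 (2017) =
arXiv:1512.09107, Corollary 3.2, Theorem 3.10, §3.8 [NewmanTassionWu2017].
-/

noncomputable section

namespace Summit.CriticalPhenomena.PercolationContinuityZ3.Theorems.Crossing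

open MeasureTheory
open Literature.Probability.Percolation Literature.Probability.LatticeModels
open Literature.Probability.Percolation.NTW17

/-- **NTW 2017, Corollary 3.2 (i) at `p_c(S_k)`, unconditional** (open circuits in annuli): for every `k ≥ 1` there
are `λ ≥ 1` and `c′ > 0` with `P_{p_c(S_k)}[an open circuit of Ā_{λn,2λn}(z) surrounds z̄] ≥ c′` for all `n ≥ 52` and
all centres `z`. [cite: NewmanTassionWu2017, Corollary 3.2 (i) and Theorem 3.10] -/
theorem NewmanTassionWu2017_cor32_i_holds {k : ℕ} (hk : 1 ≤ k) :
    ∃ lam : ℕ, 1 ≤ lam ∧ ∃ c' : ℝ, 0 < c' ∧ ∀ n : ℕ, 52 ≤ n → ∀ z : ℤ × ℤ,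
      c' ≤ (bondPercolation (slabGraph 3 k) (criticalProbIOf (slabGraph 3 k) (slabOrigin 3 k))).real
        (circuitAround k z (lam * n) (2 * (lam * n))) :=
  NewmanTassionWu2017.cor32_i NewmanTassionWu2017_thm31_holds hk (criticalProb_slab_pos_lt_one k).1
    (criticalProb_slab_pos_lt_one k).2

/-- **NTW 2017, Corollary 3.2 (ii) at `p_c(S_k)`, unconditional** (blocked annuli): for every `k ≥ 1` there is
`c > 0` with `P_{p_c(S_k)}[B̄_n ⟷^{B̄_{2n}} ∂B̄_{2n}] ≤ 1 - c` for all `n ≥ 1`. [cite: NewmanTassionWu2017, Corollary 3.2 (ii)] -/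
theorem NewmanTassionWu2017_cor32_ii_holds {k : ℕ} (hk : 1 ≤ k) :
    ∃ c : ℝ, 0 < c ∧ ∀ n : ℕ, 1 ≤ n →
      (bondPercolation (slabGraph 3 k) (criticalProbIOf (slabGraph 3 k) (slabOrigin 3 k))).real
        (slabConn k (sqBox 0 (2 * n)) (sqBox 0 n) (sqSphere 0 (2 * n))) ≤ 1 - c :=
  NewmanTassionWu2017.cor32_ii NewmanTassionWu2017_thm31_holds hk

/-- **NTW 2017, Corollary 3.2 (iii) at `p_c(S_k)`, unconditional** (polynomial decay of the one-arm probability on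
every critical slab): for every `k ≥ 1` there are `C, δ > 0` with `P_{p_c(S_k)}[B̄_m ⟷^{B̄_n} ∂B̄_n] ≤ C ((m+1)/(n+1))^δ`
for all `1 ≤ m ≤ n`. [cite: NewmanTassionWu2017, Corollary 3.2 (iii)] -/
theorem NewmanTassionWu2017_cor32_iii_holds {k : ℕ} (hk : 1 ≤ k) :
    ∃ C δ : ℝ, 0 < C ∧ 0 < δ ∧ ∀ m n : ℕ, 1 ≤ m → m ≤ n →
      (bondPercolation (slabGraph 3 k) (criticalProbIOf (slabGraph 3 k) (slabOrigin 3 k))).real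
        (slabConn k (sqBox 0 n) (sqBox 0 m) (sqSphere 0 n)) ≤ C * (((m : ℝ) + 1) / ((n : ℝ) + 1)) ^ δ :=
  NewmanTassionWu2017.cor32_iii NewmanTassionWu2017_thm31_holds hk

end Summit.CriticalPhenomena.PercolationContinuityZ3.Theorems.Crossing

end
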